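import Summits.QuantumFields.BalabanUV.Beta.FP.RelInvPeriodisedChartMinOpRecord
import Summits.QuantumFields.BalabanUV.Beta.FP.RelInvPeriodisedChartEffForm
import Summits.QuantumFields.BalabanUV.Beta.FP.TorusCompositeUnimodular
import Summits.QuantumFields.BalabanUV.Beta.FP.ColourDoublingBlocks

/-!
# `BalabanUV.Beta.FP.RelInvPeriodisedOneShot` — road «FP» (binder row D1), ROUTE T row **(T-INV)**, the OWNER's located ask W-FP-21-5 (b) =
# G-FP-21-1 «`RelInvPeriodised*` FOR THE ONE-SHOT LITERAL»: **THE CHART-GENERIC BLOCK IDENTITIES OF THE COMB-SLICED PERIODISED SYSTEM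
# (leaf-05 g29 `RelInvPeriodisedChartCombRows ∕ …ChartEffForm ∕ …ChartMinOpRecord`) AT AN ARBITRARY SITE ROOT AND AT THE ONE-SHOT SLICE OF EVERY DEPTH**

WHY.  The road's junction (J-b) (OWNER #20 `SecondVarKernelLaw`, #22 `GradedPackedHess`; memo §30 (30c)–(30d)) reads the two-point kernel of each bordered
system of the (STEP) door — one-shot `N = kkt H₀ [𝔔₀; P]`, fine `F`, coarse `G` — through the PACKED `(fields ⊕ multipliers)` blocks of its inverse («leg
currency»).  For `F` and `G` at the chart of record (III′) those blocks are the `RelInvPeriodisedComb*` instances of the chart-generic series; for `N` the slice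
is leaf-06's one-shot big comb `bigP Lc M rs hrs n = (combRowsT (bigRoot Lc rs n) (bigRatio Lc n) (towerTorus Lc M n)).submatrix (towerEquiv …).symm (fields)`
(`bigP_one` = the depth-1 door's `P` at ratio `Lc·Lc`), whose root is a SITE not syntactically `toSite r` and whose rows are RE-INDEXED by `towerEquiv`.  This
file removes exactly those two obstacles; the one-shot dressed chart `(A, 𝕄)` stays an ABSTRACT lattice pair carrying the series' five letters (an2 names it).

WHAT ([folklore] linear algebra ∕ bookkeeping over OUR typed objects BY NAME; no `def`, no `def … : Prop`, nothing cited, 0 sorry): §0 re-indexing the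
LAST row block of a doubly bordered system (`P ↦ P.submatrix e id`; `ColourDoublingBlocks.kkt_fromRows_submatrix` + `Matrix.inv_submatrix_equiv ∕
det_submatrix_equiv_self`) leaves `det kkt`, `flucCov`, the `μ`-columns of `minOp`, the `μ`-rows of `minOpL` and `(effForm …).toBlocks₁₁` UNCHANGED; §1
`exists_offset_of_range` (a site with `0 ≤ ρ_i < L` is `toSite r`, `r ∈ box (d+1) L`; leaf-06's `TorusCompositeUnimodular.bigRatio_dvd_towerTorus`
BY NAME); §2 the series ((INV)∕`h1`, Γ, I, L, S₁₁)
at an arbitrary SITE root `ρ` with `0 ≤ ρ_i < Lc` (the g29 theorems BY NAME after §1); §3 the series at the ONE-SHOT slice of depth `n` (finest torus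
`towerTorus Lc M n`, scale `bigRatio Lc n = Lc^{n+1}`, root `bigRoot Lc rs n`, rows `bigP Lc M rs hrs n`; every `n`, every box with `Lc ∣ M_i`, every in-block
root sequence `rs`): `torus_isUnit_det_kkt_oneShot_of_relInv` (the one-shot (INV)∕`h0`), `torus_flucCov_eq_oneShot_of_relInv`,
`torus_minOp(L)_submatrix_inl_oneShot_of_relInv`, `effForm_toBlocks₁₁_oneShot_of_relInv` (unfold `bigP`, §0 strips `towerEquiv`, §2 at `Lc := bigRatio Lc n`
with leaf-06's `bigRoot_range`).  DISPLAYED (an2's ∕ the OWNER's, NOT asserted): which lattice pair `(A, 𝕄)` the `(n+1)`-fold composite carries and its five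
letters at scale `bigRatio Lc n`; the identification of the door's pinned `H₀ ∕ 𝔔₀ = Q₂₀·Q₁₀` with `(perF T 𝕄)∘(ff) ∕ (perF T 𝕄).submatrix fμ (ff)` (the (B2)
assembly's).  Nothing of the landed series restated; `n = 0` gives the chart-generic statements back at `combF` (`bigP_zero`, `towerEquiv_zero`).

HONEST DEPENDENCY (page 1, mandatory): continuum YM on T⁴ ⇐ BetaPertH ∧ nine spine estimates (0/9 proved); BetaPertH ⇐ (D1) ∧ (D4) ∧ CAP+tail;
G-an2-4 gates asym, D1 and NE2/3/4.  HONEST FRAMING (cell contract, verbatim): «discharging `BetaPertH` makes Bałaban's UV stability UNCONDITIONAL —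
a real constructive-QFT result; it is NOT the continuum limit and NOT the Clay problem.»  ABSOLUTE RULE (cell charter, verbatim): «No internally-minted
statement may enter as a cited fact. Every hypothesis is either kernel-proved in this package or a verbatim quotation of a PUBLISHED theorem with page
reference. The manuscript(s) under audit are NOT citable for their own disputed steps — they are the thing under adjudication; programme-internal
(2001/route/tribunal) claims are never citable.»  0 estimates; discharges NO binder of row D1 (0∕4: hW, hR, D1Tel, D1Rep); NOT (J-a), NOT (T-ID), NOT SDF,
NOT D1, NOT BetaPertH, NOT continuum, NOT Clay.  Provenance: D1 formalisation swarm LEAF PROVER 05, unit b2b-balaban-beta-d1-formalise-leaf-05 gen 30,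
2026-08-22 (INTENT 31).  No existing file touched.
-/

noncomputable section

open scoped BigOperators Matrix

namespace Summit.QuantumFields.BalabanUV.Beta.FP.RelInvPeriodisedOneShot

open Matrix
open Literature.Probability.LatticeModels (Torus.proj)
open Literature.MathematicalPhysics.QuantumFieldTheory.Balaban1983to89
open Literature.MathematicalPhysics.QuantumFieldTheory.Balaban1983to89.Beta
open Literature.MathematicalPhysics.QuantumFieldTheory.Balaban1983to89.Beta.Composition (kkt)
open Literature.MathematicalPhysics.QuantumFieldTheory.Balaban1983to89.Beta.CompositionSingular (effForm flucCov minOp minOpL)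
open B6Lemma24Torus (pbox)
open ExpKernelCalculus (MKer shiftK)
open AffineAveraging (Site box toSite)
open OneStepResolventKernel (Fib)
open Summit.QuantumFields.BalabanUV.Beta.TameKernelCalculus (Spr)
open Summit.QuantumFields.BalabanUV.Beta.ChartConjugationRelative (RelInv)
open Summit.QuantumFields.BalabanUV.Beta.AxialDressingRooted (axEc)
open Summit.QuantumFields.BalabanUV.Beta.FP.KernelPeriodisationFib (Idx perF)
open Summit.QuantumFields.BalabanUV.Beta.FP.TorusCombRows (Res combRowsT)
open Summit.QuantumFields.BalabanUV.Beta.FP.TorusCompositeObjects (towerTorus bigRatio bigRatio_pos bigRoot bigRoot_range bigP towerEquiv)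
open Summit.QuantumFields.BalabanUV.Beta.FP.TorusCompositeUnimodular (bigRatio_dvd_towerTorus)
open Summit.QuantumFields.BalabanUV.Beta.FP.ColourDoublingBlocks (kkt_fromRows_submatrix)
open Summit.QuantumFields.BalabanUV.Beta.FP.RelInvPeriodisedChartCombRows (torus_isUnit_det_kkt_combRows_of_relInv)
open Summit.QuantumFields.BalabanUV.Beta.FP.RelInvPeriodisedChartEffForm (effForm_toBlocks₁₁_of_relInv)
open Summit.QuantumFields.BalabanUV.Beta.FP.RelInvPeriodisedChartMinOpRecord (torus_minOp_submatrix_inl_of_relInv torus_minOpL_submatrix_inl_of_relInv torus_flucCov_eq_of_relInv)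

/-! ## §0 Re-indexing the last row block of a doubly bordered system changes none of the packed blocks -/

section Reindex
variable {ν μ ρ ρ' : Type*} [Fintype ν] [Fintype μ] [Fintype ρ] [Fintype ρ'] [DecidableEq ν] [DecidableEq μ] [DecidableEq ρ] [DecidableEq ρ']
  (K : Matrix ν ν ℝ) (Q : Matrix μ ν ℝ) (P : Matrix ρ ν ℝ) (e : ρ' ≃ ρ)

/-- [folklore] the inverse of the doubly bordered matrix with its last row block re-indexed is the re-indexed inverse. -/
theorem kktInv_fromRows_reindex :
    (kkt K (fromRows Q (P.submatrix e id)))⁻¹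
      = ((kkt K (fromRows Q P))⁻¹).submatrix (Equiv.sumCongr (Equiv.refl ν) (Equiv.sumCongr (Equiv.refl μ) e))
          (Equiv.sumCongr (Equiv.refl ν) (Equiv.sumCongr (Equiv.refl μ) e)) := by
  rw [kkt_fromRows_submatrix, Matrix.inv_submatrix_equiv]

/-- [folklore] … and its determinant is unchanged. -/
theorem det_kkt_fromRows_reindex : (kkt K (fromRows Q (P.submatrix e id))).det = (kkt K (fromRows Q P)).det := by
  rw [kkt_fromRows_submatrix, Matrix.det_submatrix_equiv_self]

/-- [folklore] the fluctuation covariance does not see a re-indexing of the slice rows. -/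
theorem flucCov_fromRows_reindex : flucCov K (fromRows Q (P.submatrix e id)) = flucCov K (fromRows Q P) := by
  ext i j
  simp only [flucCov, Matrix.toBlocks₁₁, Matrix.of_apply, kktInv_fromRows_reindex, Matrix.submatrix_apply, Equiv.sumCongr_apply, Sum.map_inl, Equiv.coe_refl, id]

/-- [folklore] the `μ`-columns of the minimiser operator do not see a re-indexing of the slice rows. -/
theorem minOp_submatrix_inl_fromRows_reindex :
    (minOp K (fromRows Q (P.submatrix e id))).submatrix id Sum.inl = (minOp K (fromRows Q P)).submatrix id Sum.inl := by
  ext i a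
  simp only [minOp, Matrix.toBlocks₁₂, Matrix.of_apply, kktInv_fromRows_reindex, Matrix.submatrix_apply, Equiv.sumCongr_apply, Sum.map_inl, Sum.map_inr, Equiv.coe_refl, id]

/-- [folklore] the `μ`-rows of the left companion do not see a re-indexing of the slice rows. -/
theorem minOpL_submatrix_inl_fromRows_reindex :
    (minOpL K (fromRows Q (P.submatrix e id))).submatrix Sum.inl id = (minOpL K (fromRows Q P)).submatrix Sum.inl id := by
  ext a i
  simp only [minOpL, Matrix.toBlocks₂₁, Matrix.of_apply, kktInv_fromRows_reindex, Matrix.submatrix_apply, Equiv.sumCongr_apply, Sum.map_inl, Sum.map_inr, Equiv.coe_refl, id]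

/-- [folklore] the `μμ` corner of the effective form does not see a re-indexing of the slice rows. -/
theorem effForm_toBlocks₁₁_fromRows_reindex :
    (effForm K (fromRows Q (P.submatrix e id))).toBlocks₁₁ = (effForm K (fromRows Q P)).toBlocks₁₁ := by
  ext a b
  simp only [effForm, Matrix.toBlocks₂₂, Matrix.toBlocks₁₁, Matrix.of_apply, Matrix.neg_apply, kktInv_fromRows_reindex, Matrix.submatrix_apply,
    Equiv.sumCongr_apply, Sum.map_inr, Sum.map_inl, Equiv.coe_refl, id]

end Reindex

/-! ## §1 Bookkeeping: site roots in a block are `toSite` of an offset -/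

section Bookkeeping

variable {d : ℕ}

/-- [folklore] a site `ρ` with `0 ≤ ρ_i < L` is `toSite r` for an offset `r ∈ box (d+1) L`. -/
theorem exists_offset_of_range {L : ℕ} {ρ : Site (d + 1)} (hρ : ∀ i, 0 ≤ ρ i ∧ ρ i < (L : ℤ)) :
    ∃ r : Fin (d + 1) → ℕ, r ∈ box (d + 1) L ∧ toSite r = ρ := by
  refine ⟨fun i => (ρ i).toNat, Fintype.mem_piFinset.mpr fun i => Finset.mem_range.mpr ?_, funext fun i => ?_⟩
  · have h := hρ i; omega
  · have h := hρ i; simp only [toSite]; omega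

end Bookkeeping

/-! ## §2 The chart-generic series at an arbitrary SITE root `ρ` in the block (`0 ≤ ρ_i < Lc`) -/

section SiteRoot

variable {d : ℕ} {Lc : ℕ} [NeZero Lc] {ρ : Site (d + 1)} (M : Fin (d + 1) → ℕ) [∀ μ, NeZero (M μ)] {A Mh : MKer (d + 1) (Fib d)}

set_option synthInstance.maxSize 1024 in
/-- [folklore] **(INV) ∕ `h1` AT A SITE ROOT**: `RelInvPeriodisedChartCombRows.torus_isUnit_det_kkt_combRows_of_relInv` with `toSite r ↦ ρ`, `0 ≤ ρ_i < Lc`. -/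
theorem torus_isUnit_det_kkt_combRows_of_relInv_site (hρ : ∀ i, 0 ≤ ρ i ∧ ρ i < (Lc : ℤ)) (hM : ∀ i, Lc ∣ M i) (hA : Spr A) (hMh : Spr Mh)
    (hAt : ∀ t : Fin (d + 1) → ℤ, shiftK ((Lc : ℤ) • t) A = A) (hMt : ∀ t : Fin (d + 1) → ℤ, shiftK ((Lc : ℤ) • t) Mh = Mh)
    (hrel : RelInv A Mh (axEc ρ Lc))
    (hmm : ∀ (x y : Fin (d + 1) → ℤ) (κ l : Fin (d + 1)), Mh x y (Sum.inr κ) (Sum.inr l) = 0)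
    (hanti : ∀ (x y : Fin (d + 1) → ℤ) (κ l : Fin (d + 1)), Mh x y (Sum.inl κ) (Sum.inr l) = -Mh y x (Sum.inr l) (Sum.inl κ))
    {μ : Type*} [Fintype μ] [DecidableEq μ] (fμ : μ → Idx M (Fib d)) (hfμ : Function.Injective fμ)
    (hμ : ∀ a : μ, ∃ m : Fin (d + 1), (fμ a).2 = Sum.inr m)
    (hcoarse : ∀ (s : ↥(pbox M)) (m : Fin (d + 1)), ((s, Sum.inr m) : Idx M (Fib d)) ∈ Set.range fμ ↔ Torus.proj Lc (s : Site (d + 1)) = 0) :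
    IsUnit (kkt
      ((perF M Mh).submatrix (fun b : ↥(pbox M) × Fin (d + 1) => ((b.1, Sum.inl b.2) : Idx M (Fib d)))
        (fun b : ↥(pbox M) × Fin (d + 1) => ((b.1, Sum.inl b.2) : Idx M (Fib d))))
      (fromRows
        ((perF M Mh).submatrix fμ (fun b : ↥(pbox M) × Fin (d + 1) => ((b.1, Sum.inl b.2) : Idx M (Fib d))))
        ((combRowsT ρ Lc M).submatrix id (fun b : ↥(pbox M) × Fin (d + 1) => ((b.1, Sum.inl b.2) : Idx M (Fib d)))))).det := by
  obtain ⟨r, hr, rfl⟩ := exists_offset_of_range hρ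
  exact torus_isUnit_det_kkt_combRows_of_relInv M hr hM hA hMh hAt hMt hrel hmm hanti fμ hfμ hμ hcoarse

set_option synthInstance.maxSize 1024 in
/-- [folklore] **Γ AT A SITE ROOT**: `RelInvPeriodisedChartMinOpRecord.torus_flucCov_eq_of_relInv` with `toSite r ↦ ρ`. -/
theorem torus_flucCov_eq_of_relInv_site (hρ : ∀ i, 0 ≤ ρ i ∧ ρ i < (Lc : ℤ)) (hM : ∀ i, Lc ∣ M i) (hA : Spr A) (hMh : Spr Mh)
    (hAt : ∀ t : Fin (d + 1) → ℤ, shiftK ((Lc : ℤ) • t) A = A) (hMt : ∀ t : Fin (d + 1) → ℤ, shiftK ((Lc : ℤ) • t) Mh = Mh)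
    (hrel : RelInv A Mh (axEc ρ Lc))
    (hmm : ∀ (x y : Fin (d + 1) → ℤ) (κ l : Fin (d + 1)), Mh x y (Sum.inr κ) (Sum.inr l) = 0)
    (hanti : ∀ (x y : Fin (d + 1) → ℤ) (κ l : Fin (d + 1)), Mh x y (Sum.inl κ) (Sum.inr l) = -Mh y x (Sum.inr l) (Sum.inl κ))
    {μ : Type*} [Fintype μ] [DecidableEq μ] (fμ : μ → Idx M (Fib d)) (hfμ : Function.Injective fμ)
    (hμ : ∀ a : μ, ∃ m : Fin (d + 1), (fμ a).2 = Sum.inr m)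
    (hcoarse : ∀ (s : ↥(pbox M)) (m : Fin (d + 1)), ((s, Sum.inr m) : Idx M (Fib d)) ∈ Set.range fμ ↔ Torus.proj Lc (s : Site (d + 1)) = 0) :
    flucCov ((perF M Mh).submatrix (fun b : ↥(pbox M) × Fin (d + 1) => ((b.1, Sum.inl b.2) : Idx M (Fib d)))
          (fun b : ↥(pbox M) × Fin (d + 1) => ((b.1, Sum.inl b.2) : Idx M (Fib d))))
        (fromRows
          ((perF M Mh).submatrix fμ (fun b : ↥(pbox M) × Fin (d + 1) => ((b.1, Sum.inl b.2) : Idx M (Fib d))))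
          ((combRowsT ρ Lc M).submatrix id (fun b : ↥(pbox M) × Fin (d + 1) => ((b.1, Sum.inl b.2) : Idx M (Fib d)))))
      = Matrix.of fun (b b' : ↥(pbox M) × Fin (d + 1)) =>
          axEc ρ Lc (b.1 : Site (d + 1)) (b.1 : Site (d + 1)) (Sum.inl b.2) (Sum.inl b.2)
            * (axEc ρ Lc (b'.1 : Site (d + 1)) (b'.1 : Site (d + 1)) (Sum.inl b'.2) (Sum.inl b'.2)
              * perF M A (b.1, Sum.inl b.2) (b'.1, Sum.inl b'.2)) := by
  obtain ⟨r, hr, rfl⟩ := exists_offset_of_range hρ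
  exact torus_flucCov_eq_of_relInv M hr hM hA hMh hAt hMt hrel hmm hanti fμ hfμ hμ hcoarse

set_option synthInstance.maxSize 1024 in
/-- [folklore] **I AT A SITE ROOT**: the `μ`-columns of the minimiser operator, `RelInvPeriodisedChartMinOpRecord.torus_minOp_submatrix_inl_of_relInv` with `toSite r ↦ ρ`. -/
theorem torus_minOp_submatrix_inl_of_relInv_site (hρ : ∀ i, 0 ≤ ρ i ∧ ρ i < (Lc : ℤ)) (hM : ∀ i, Lc ∣ M i) (hA : Spr A) (hMh : Spr Mh)
    (hAt : ∀ t : Fin (d + 1) → ℤ, shiftK ((Lc : ℤ) • t) A = A) (hMt : ∀ t : Fin (d + 1) → ℤ, shiftK ((Lc : ℤ) • t) Mh = Mh)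
    (hrel : RelInv A Mh (axEc ρ Lc))
    (hmm : ∀ (x y : Fin (d + 1) → ℤ) (κ l : Fin (d + 1)), Mh x y (Sum.inr κ) (Sum.inr l) = 0)
    (hanti : ∀ (x y : Fin (d + 1) → ℤ) (κ l : Fin (d + 1)), Mh x y (Sum.inl κ) (Sum.inr l) = -Mh y x (Sum.inr l) (Sum.inl κ))
    {μ : Type*} [Fintype μ] [DecidableEq μ] (fμ : μ → Idx M (Fib d)) (hfμ : Function.Injective fμ)
    (hμ : ∀ a : μ, ∃ m : Fin (d + 1), (fμ a).2 = Sum.inr m)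
    (hcoarse : ∀ (s : ↥(pbox M)) (m : Fin (d + 1)), ((s, Sum.inr m) : Idx M (Fib d)) ∈ Set.range fμ ↔ Torus.proj Lc (s : Site (d + 1)) = 0) :
    (minOp ((perF M Mh).submatrix (fun b : ↥(pbox M) × Fin (d + 1) => ((b.1, Sum.inl b.2) : Idx M (Fib d)))
          (fun b : ↥(pbox M) × Fin (d + 1) => ((b.1, Sum.inl b.2) : Idx M (Fib d))))
        (fromRows
          ((perF M Mh).submatrix fμ (fun b : ↥(pbox M) × Fin (d + 1) => ((b.1, Sum.inl b.2) : Idx M (Fib d))))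
          ((combRowsT ρ Lc M).submatrix id (fun b : ↥(pbox M) × Fin (d + 1) => ((b.1, Sum.inl b.2) : Idx M (Fib d)))))).submatrix
        id Sum.inl
      = Matrix.of fun (b : ↥(pbox M) × Fin (d + 1)) (a : μ) =>
          axEc ρ Lc (b.1 : Site (d + 1)) (b.1 : Site (d + 1)) (Sum.inl b.2) (Sum.inl b.2) * perF M A (b.1, Sum.inl b.2) (fμ a) := by
  obtain ⟨r, hr, rfl⟩ := exists_offset_of_range hρ
  exact torus_minOp_submatrix_inl_of_relInv M hr hM hA hMh hAt hMt hrel hmm hanti fμ hfμ hμ hcoarse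

set_option synthInstance.maxSize 1024 in
/-- [folklore] **L AT A SITE ROOT**: the `μ`-rows of the left companion, `RelInvPeriodisedChartMinOpRecord.torus_minOpL_submatrix_inl_of_relInv` with `toSite r ↦ ρ`. -/
theorem torus_minOpL_submatrix_inl_of_relInv_site (hρ : ∀ i, 0 ≤ ρ i ∧ ρ i < (Lc : ℤ)) (hM : ∀ i, Lc ∣ M i) (hA : Spr A) (hMh : Spr Mh)
    (hAt : ∀ t : Fin (d + 1) → ℤ, shiftK ((Lc : ℤ) • t) A = A) (hMt : ∀ t : Fin (d + 1) → ℤ, shiftK ((Lc : ℤ) • t) Mh = Mh)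
    (hrel : RelInv A Mh (axEc ρ Lc))
    (hmm : ∀ (x y : Fin (d + 1) → ℤ) (κ l : Fin (d + 1)), Mh x y (Sum.inr κ) (Sum.inr l) = 0)
    (hanti : ∀ (x y : Fin (d + 1) → ℤ) (κ l : Fin (d + 1)), Mh x y (Sum.inl κ) (Sum.inr l) = -Mh y x (Sum.inr l) (Sum.inl κ))
    {μ : Type*} [Fintype μ] [DecidableEq μ] (fμ : μ → Idx M (Fib d)) (hfμ : Function.Injective fμ)
    (hμ : ∀ a : μ, ∃ m : Fin (d + 1), (fμ a).2 = Sum.inr m)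
    (hcoarse : ∀ (s : ↥(pbox M)) (m : Fin (d + 1)), ((s, Sum.inr m) : Idx M (Fib d)) ∈ Set.range fμ ↔ Torus.proj Lc (s : Site (d + 1)) = 0) :
    (minOpL ((perF M Mh).submatrix (fun b : ↥(pbox M) × Fin (d + 1) => ((b.1, Sum.inl b.2) : Idx M (Fib d)))
          (fun b : ↥(pbox M) × Fin (d + 1) => ((b.1, Sum.inl b.2) : Idx M (Fib d))))
        (fromRows
          ((perF M Mh).submatrix fμ (fun b : ↥(pbox M) × Fin (d + 1) => ((b.1, Sum.inl b.2) : Idx M (Fib d))))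
          ((combRowsT ρ Lc M).submatrix id (fun b : ↥(pbox M) × Fin (d + 1) => ((b.1, Sum.inl b.2) : Idx M (Fib d)))))).submatrix
        Sum.inl id
      = -Matrix.of fun (a : μ) (b : ↥(pbox M) × Fin (d + 1)) =>
          axEc ρ Lc (b.1 : Site (d + 1)) (b.1 : Site (d + 1)) (Sum.inl b.2) (Sum.inl b.2) * perF M A (fμ a) (b.1, Sum.inl b.2) := by
  obtain ⟨r, hr, rfl⟩ := exists_offset_of_range hρ
  exact torus_minOpL_submatrix_inl_of_relInv M hr hM hA hMh hAt hMt hrel hmm hanti fμ hfμ hμ hcoarse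

set_option synthInstance.maxSize 1024 in
/-- [folklore] **S₁₁ AT A SITE ROOT**: the `μμ` corner of the effective form, `RelInvPeriodisedChartEffForm.effForm_toBlocks₁₁_of_relInv` with `toSite r ↦ ρ`. -/
theorem effForm_toBlocks₁₁_of_relInv_site (hρ : ∀ i, 0 ≤ ρ i ∧ ρ i < (Lc : ℤ)) (hM : ∀ i, Lc ∣ M i) (hA : Spr A) (hMh : Spr Mh)
    (hAt : ∀ t : Fin (d + 1) → ℤ, shiftK ((Lc : ℤ) • t) A = A) (hMt : ∀ t : Fin (d + 1) → ℤ, shiftK ((Lc : ℤ) • t) Mh = Mh)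
    (hrel : RelInv A Mh (axEc ρ Lc))
    (hmm : ∀ (x y : Fin (d + 1) → ℤ) (κ l : Fin (d + 1)), Mh x y (Sum.inr κ) (Sum.inr l) = 0)
    (hanti : ∀ (x y : Fin (d + 1) → ℤ) (κ l : Fin (d + 1)), Mh x y (Sum.inl κ) (Sum.inr l) = -Mh y x (Sum.inr l) (Sum.inl κ))
    {μ : Type*} [Fintype μ] [DecidableEq μ] (fμ : μ → Idx M (Fib d)) (hfμ : Function.Injective fμ)
    (hμ : ∀ a : μ, ∃ m : Fin (d + 1), (fμ a).2 = Sum.inr m)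
    (hcoarse : ∀ (s : ↥(pbox M)) (m : Fin (d + 1)), ((s, Sum.inr m) : Idx M (Fib d)) ∈ Set.range fμ ↔ Torus.proj Lc (s : Site (d + 1)) = 0) :
    (effForm ((perF M Mh).submatrix (fun b : ↥(pbox M) × Fin (d + 1) => ((b.1, Sum.inl b.2) : Idx M (Fib d)))
          (fun b : ↥(pbox M) × Fin (d + 1) => ((b.1, Sum.inl b.2) : Idx M (Fib d))))
        (fromRows
          ((perF M Mh).submatrix fμ (fun b : ↥(pbox M) × Fin (d + 1) => ((b.1, Sum.inl b.2) : Idx M (Fib d))))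
          ((combRowsT ρ Lc M).submatrix id (fun b : ↥(pbox M) × Fin (d + 1) => ((b.1, Sum.inl b.2) : Idx M (Fib d)))))).toBlocks₁₁
      = (perF M A).submatrix fμ fμ := by
  obtain ⟨r, hr, rfl⟩ := exists_offset_of_range hρ
  exact effForm_toBlocks₁₁_of_relInv M hr hM hA hMh hAt hMt hrel hmm hanti fμ hfμ hμ hcoarse

end SiteRoot

/-! ## §3 The series at the ONE-SHOT slice of depth `n`: finest torus `towerTorus Lc M n`, scale `bigRatio Lc n`, root `bigRoot Lc rs n`, rows `bigP` -/

section OneShot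

variable {d : ℕ} (Lc : ℕ) [NeZero Lc] (M : Fin (d + 1) → ℕ) [∀ μ, NeZero (M μ)] (rs : ℕ → (Fin (d + 1) → ℕ))
  (hrs : ∀ k i, 0 ≤ toSite (rs k) i ∧ toSite (rs k) i < (Lc : ℤ)) (n : ℕ) {A Mh : MKer (d + 1) (Fib d)}

omit [∀ μ, NeZero (M μ)] in
/-- [folklore] `bigP` unfolded as «the comb rows on the field slots, re-indexed in the row» (`rfl`). -/
theorem bigP_eq_submatrix :
    bigP Lc M rs hrs n
      = (((combRowsT (bigRoot Lc rs n) (bigRatio Lc n) (towerTorus Lc M n)).submatrix id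
            (fun b : ↥(pbox (towerTorus Lc M n)) × Fin (d + 1) => ((b.1, Sum.inl b.2) : Idx (towerTorus Lc M n) (Fib d)))).submatrix
          (towerEquiv Lc M rs hrs n).symm id) := rfl

set_option synthInstance.maxSize 1024 in
/-- [folklore] **THE ONE-SHOT (INV) ∕ `h0`**: for ANY lattice chart `(A, 𝕄)` carrying the five letters at scale `bigRatio Lc n` and root `bigRoot Lc rs n`
(DISPLAYED — an2 names the `(n+1)`-fold composite's chart), the field block of `perF T 𝕄` (`T := towerTorus Lc M n`) bordered by its rows at any injective
`inr`-valued coarse presentation `fμ` (`hcoarse` at scale `bigRatio Lc n`) and by leaf-06's ONE-SHOT comb rows `bigP Lc M rs hrs n` is non-degenerate. -/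
theorem torus_isUnit_det_kkt_oneShot_of_relInv (hM : ∀ i, Lc ∣ M i) (hA : Spr A) (hMh : Spr Mh)
    (hAt : ∀ t : Fin (d + 1) → ℤ, shiftK ((bigRatio Lc n : ℤ) • t) A = A) (hMt : ∀ t : Fin (d + 1) → ℤ, shiftK ((bigRatio Lc n : ℤ) • t) Mh = Mh)
    (hrel : RelInv A Mh (axEc (bigRoot Lc rs n) (bigRatio Lc n)))
    (hmm : ∀ (x y : Fin (d + 1) → ℤ) (κ l : Fin (d + 1)), Mh x y (Sum.inr κ) (Sum.inr l) = 0)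
    (hanti : ∀ (x y : Fin (d + 1) → ℤ) (κ l : Fin (d + 1)), Mh x y (Sum.inl κ) (Sum.inr l) = -Mh y x (Sum.inr l) (Sum.inl κ))
    {μ : Type*} [Fintype μ] [DecidableEq μ] (fμ : μ → Idx (towerTorus Lc M n) (Fib d)) (hfμ : Function.Injective fμ)
    (hμ : ∀ a : μ, ∃ m : Fin (d + 1), (fμ a).2 = Sum.inr m)
    (hcoarse : ∀ (s : ↥(pbox (towerTorus Lc M n))) (m : Fin (d + 1)),
      ((s, Sum.inr m) : Idx (towerTorus Lc M n) (Fib d)) ∈ Set.range fμ ↔ Torus.proj (bigRatio Lc n) (s : Site (d + 1)) = 0) :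
    IsUnit (kkt
      ((perF (towerTorus Lc M n) Mh).submatrix (fun b : ↥(pbox (towerTorus Lc M n)) × Fin (d + 1) => ((b.1, Sum.inl b.2) : Idx (towerTorus Lc M n) (Fib d)))
        (fun b : ↥(pbox (towerTorus Lc M n)) × Fin (d + 1) => ((b.1, Sum.inl b.2) : Idx (towerTorus Lc M n) (Fib d))))
      (fromRows
        ((perF (towerTorus Lc M n) Mh).submatrix fμ
          (fun b : ↥(pbox (towerTorus Lc M n)) × Fin (d + 1) => ((b.1, Sum.inl b.2) : Idx (towerTorus Lc M n) (Fib d))))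
        (bigP Lc M rs hrs n))).det := by
  have hLc : 0 < Lc := Nat.pos_of_ne_zero (NeZero.ne Lc)
  haveI : NeZero (bigRatio Lc n) := ⟨(bigRatio_pos Lc hLc n).ne'⟩
  rw [bigP_eq_submatrix, isUnit_iff_ne_zero, det_kkt_fromRows_reindex, ← isUnit_iff_ne_zero]
  exact torus_isUnit_det_kkt_combRows_of_relInv_site (towerTorus Lc M n) (bigRoot_range Lc hLc n rs hrs) (bigRatio_dvd_towerTorus Lc hM n)
    hA hMh hAt hMt hrel hmm hanti fμ hfμ hμ hcoarse

set_option synthInstance.maxSize 1024 in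
/-- [folklore] **THE ONE-SHOT Γ**: the fluctuation covariance of the one-shot sliced system is `+perF T A` between non-comb field slots of the big comb,
`0` as soon as one slot is on it — `axEc (bigRoot Lc rs n) (bigRatio Lc n)`-masked (same displayed letters). -/
theorem torus_flucCov_eq_oneShot_of_relInv (hM : ∀ i, Lc ∣ M i) (hA : Spr A) (hMh : Spr Mh)
    (hAt : ∀ t : Fin (d + 1) → ℤ, shiftK ((bigRatio Lc n : ℤ) • t) A = A) (hMt : ∀ t : Fin (d + 1) → ℤ, shiftK ((bigRatio Lc n : ℤ) • t) Mh = Mh)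
    (hrel : RelInv A Mh (axEc (bigRoot Lc rs n) (bigRatio Lc n)))
    (hmm : ∀ (x y : Fin (d + 1) → ℤ) (κ l : Fin (d + 1)), Mh x y (Sum.inr κ) (Sum.inr l) = 0)
    (hanti : ∀ (x y : Fin (d + 1) → ℤ) (κ l : Fin (d + 1)), Mh x y (Sum.inl κ) (Sum.inr l) = -Mh y x (Sum.inr l) (Sum.inl κ))
    {μ : Type*} [Fintype μ] [DecidableEq μ] (fμ : μ → Idx (towerTorus Lc M n) (Fib d)) (hfμ : Function.Injective fμ)
    (hμ : ∀ a : μ, ∃ m : Fin (d + 1), (fμ a).2 = Sum.inr m)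
    (hcoarse : ∀ (s : ↥(pbox (towerTorus Lc M n))) (m : Fin (d + 1)),
      ((s, Sum.inr m) : Idx (towerTorus Lc M n) (Fib d)) ∈ Set.range fμ ↔ Torus.proj (bigRatio Lc n) (s : Site (d + 1)) = 0) :
    flucCov
        ((perF (towerTorus Lc M n) Mh).submatrix (fun b : ↥(pbox (towerTorus Lc M n)) × Fin (d + 1) => ((b.1, Sum.inl b.2) : Idx (towerTorus Lc M n) (Fib d)))
          (fun b : ↥(pbox (towerTorus Lc M n)) × Fin (d + 1) => ((b.1, Sum.inl b.2) : Idx (towerTorus Lc M n) (Fib d))))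
        (fromRows
          ((perF (towerTorus Lc M n) Mh).submatrix fμ
            (fun b : ↥(pbox (towerTorus Lc M n)) × Fin (d + 1) => ((b.1, Sum.inl b.2) : Idx (towerTorus Lc M n) (Fib d))))
          (bigP Lc M rs hrs n))
      = Matrix.of fun (b b' : ↥(pbox (towerTorus Lc M n)) × Fin (d + 1)) =>
          axEc (bigRoot Lc rs n) (bigRatio Lc n) (b.1 : Site (d + 1)) (b.1 : Site (d + 1)) (Sum.inl b.2) (Sum.inl b.2)
            * (axEc (bigRoot Lc rs n) (bigRatio Lc n) (b'.1 : Site (d + 1)) (b'.1 : Site (d + 1)) (Sum.inl b'.2) (Sum.inl b'.2)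
              * perF (towerTorus Lc M n) A (b.1, Sum.inl b.2) (b'.1, Sum.inl b'.2)) := by
  have hLc : 0 < Lc := Nat.pos_of_ne_zero (NeZero.ne Lc)
  haveI : NeZero (bigRatio Lc n) := ⟨(bigRatio_pos Lc hLc n).ne'⟩
  rw [bigP_eq_submatrix, flucCov_fromRows_reindex]
  exact torus_flucCov_eq_of_relInv_site (towerTorus Lc M n) (bigRoot_range Lc hLc n rs hrs) (bigRatio_dvd_towerTorus Lc hM n)
    hA hMh hAt hMt hrel hmm hanti fμ hfμ hμ hcoarse

set_option synthInstance.maxSize 1024 in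
/-- [folklore] **THE ONE-SHOT I**: the `μ`-columns of the one-shot minimiser operator are `+perF T A` (field × multiplier), masked on the big comb. -/
theorem torus_minOp_submatrix_inl_oneShot_of_relInv (hM : ∀ i, Lc ∣ M i) (hA : Spr A) (hMh : Spr Mh)
    (hAt : ∀ t : Fin (d + 1) → ℤ, shiftK ((bigRatio Lc n : ℤ) • t) A = A) (hMt : ∀ t : Fin (d + 1) → ℤ, shiftK ((bigRatio Lc n : ℤ) • t) Mh = Mh)
    (hrel : RelInv A Mh (axEc (bigRoot Lc rs n) (bigRatio Lc n)))
    (hmm : ∀ (x y : Fin (d + 1) → ℤ) (κ l : Fin (d + 1)), Mh x y (Sum.inr κ) (Sum.inr l) = 0)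
    (hanti : ∀ (x y : Fin (d + 1) → ℤ) (κ l : Fin (d + 1)), Mh x y (Sum.inl κ) (Sum.inr l) = -Mh y x (Sum.inr l) (Sum.inl κ))
    {μ : Type*} [Fintype μ] [DecidableEq μ] (fμ : μ → Idx (towerTorus Lc M n) (Fib d)) (hfμ : Function.Injective fμ)
    (hμ : ∀ a : μ, ∃ m : Fin (d + 1), (fμ a).2 = Sum.inr m)
    (hcoarse : ∀ (s : ↥(pbox (towerTorus Lc M n))) (m : Fin (d + 1)),
      ((s, Sum.inr m) : Idx (towerTorus Lc M n) (Fib d)) ∈ Set.range fμ ↔ Torus.proj (bigRatio Lc n) (s : Site (d + 1)) = 0) :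
    (minOp
        ((perF (towerTorus Lc M n) Mh).submatrix (fun b : ↥(pbox (towerTorus Lc M n)) × Fin (d + 1) => ((b.1, Sum.inl b.2) : Idx (towerTorus Lc M n) (Fib d)))
          (fun b : ↥(pbox (towerTorus Lc M n)) × Fin (d + 1) => ((b.1, Sum.inl b.2) : Idx (towerTorus Lc M n) (Fib d))))
        (fromRows
          ((perF (towerTorus Lc M n) Mh).submatrix fμ
            (fun b : ↥(pbox (towerTorus Lc M n)) × Fin (d + 1) => ((b.1, Sum.inl b.2) : Idx (towerTorus Lc M n) (Fib d))))
          (bigP Lc M rs hrs n))).submatrix id Sum.inl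
      = Matrix.of fun (b : ↥(pbox (towerTorus Lc M n)) × Fin (d + 1)) (a : μ) =>
          axEc (bigRoot Lc rs n) (bigRatio Lc n) (b.1 : Site (d + 1)) (b.1 : Site (d + 1)) (Sum.inl b.2) (Sum.inl b.2)
            * perF (towerTorus Lc M n) A (b.1, Sum.inl b.2) (fμ a) := by
  have hLc : 0 < Lc := Nat.pos_of_ne_zero (NeZero.ne Lc)
  haveI : NeZero (bigRatio Lc n) := ⟨(bigRatio_pos Lc hLc n).ne'⟩
  rw [bigP_eq_submatrix, minOp_submatrix_inl_fromRows_reindex]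
  exact torus_minOp_submatrix_inl_of_relInv_site (towerTorus Lc M n) (bigRoot_range Lc hLc n rs hrs) (bigRatio_dvd_towerTorus Lc hM n)
    hA hMh hAt hMt hrel hmm hanti fμ hfμ hμ hcoarse

set_option synthInstance.maxSize 1024 in
/-- [folklore] **THE ONE-SHOT L**: the `μ`-rows of the one-shot left companion are `−perF T A` (multiplier × field), masked on the big comb. -/
theorem torus_minOpL_submatrix_inl_oneShot_of_relInv (hM : ∀ i, Lc ∣ M i) (hA : Spr A) (hMh : Spr Mh)
    (hAt : ∀ t : Fin (d + 1) → ℤ, shiftK ((bigRatio Lc n : ℤ) • t) A = A) (hMt : ∀ t : Fin (d + 1) → ℤ, shiftK ((bigRatio Lc n : ℤ) • t) Mh = Mh)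
    (hrel : RelInv A Mh (axEc (bigRoot Lc rs n) (bigRatio Lc n)))
    (hmm : ∀ (x y : Fin (d + 1) → ℤ) (κ l : Fin (d + 1)), Mh x y (Sum.inr κ) (Sum.inr l) = 0)
    (hanti : ∀ (x y : Fin (d + 1) → ℤ) (κ l : Fin (d + 1)), Mh x y (Sum.inl κ) (Sum.inr l) = -Mh y x (Sum.inr l) (Sum.inl κ))
    {μ : Type*} [Fintype μ] [DecidableEq μ] (fμ : μ → Idx (towerTorus Lc M n) (Fib d)) (hfμ : Function.Injective fμ)
    (hμ : ∀ a : μ, ∃ m : Fin (d + 1), (fμ a).2 = Sum.inr m)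
    (hcoarse : ∀ (s : ↥(pbox (towerTorus Lc M n))) (m : Fin (d + 1)),
      ((s, Sum.inr m) : Idx (towerTorus Lc M n) (Fib d)) ∈ Set.range fμ ↔ Torus.proj (bigRatio Lc n) (s : Site (d + 1)) = 0) :
    (minOpL
        ((perF (towerTorus Lc M n) Mh).submatrix (fun b : ↥(pbox (towerTorus Lc M n)) × Fin (d + 1) => ((b.1, Sum.inl b.2) : Idx (towerTorus Lc M n) (Fib d)))
          (fun b : ↥(pbox (towerTorus Lc M n)) × Fin (d + 1) => ((b.1, Sum.inl b.2) : Idx (towerTorus Lc M n) (Fib d))))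
        (fromRows
          ((perF (towerTorus Lc M n) Mh).submatrix fμ
            (fun b : ↥(pbox (towerTorus Lc M n)) × Fin (d + 1) => ((b.1, Sum.inl b.2) : Idx (towerTorus Lc M n) (Fib d))))
          (bigP Lc M rs hrs n))).submatrix Sum.inl id
      = -Matrix.of fun (a : μ) (b : ↥(pbox (towerTorus Lc M n)) × Fin (d + 1)) =>
          axEc (bigRoot Lc rs n) (bigRatio Lc n) (b.1 : Site (d + 1)) (b.1 : Site (d + 1)) (Sum.inl b.2) (Sum.inl b.2)
            * perF (towerTorus Lc M n) A (fμ a) (b.1, Sum.inl b.2) := by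
  have hLc : 0 < Lc := Nat.pos_of_ne_zero (NeZero.ne Lc)
  haveI : NeZero (bigRatio Lc n) := ⟨(bigRatio_pos Lc hLc n).ne'⟩
  rw [bigP_eq_submatrix, minOpL_submatrix_inl_fromRows_reindex]
  exact torus_minOpL_submatrix_inl_of_relInv_site (towerTorus Lc M n) (bigRoot_range Lc hLc n rs hrs) (bigRatio_dvd_towerTorus Lc hM n)
    hA hMh hAt hMt hrel hmm hanti fμ hfμ hμ hcoarse

set_option synthInstance.maxSize 1024 in
/-- [folklore] **THE ONE-SHOT S₁₁**: the `μμ` corner of the one-shot effective form is the `μ`-block of `perF T A` (no mask — coarse multipliers sit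
off the field slots). -/
theorem effForm_toBlocks₁₁_oneShot_of_relInv (hM : ∀ i, Lc ∣ M i) (hA : Spr A) (hMh : Spr Mh)
    (hAt : ∀ t : Fin (d + 1) → ℤ, shiftK ((bigRatio Lc n : ℤ) • t) A = A) (hMt : ∀ t : Fin (d + 1) → ℤ, shiftK ((bigRatio Lc n : ℤ) • t) Mh = Mh)
    (hrel : RelInv A Mh (axEc (bigRoot Lc rs n) (bigRatio Lc n)))
    (hmm : ∀ (x y : Fin (d + 1) → ℤ) (κ l : Fin (d + 1)), Mh x y (Sum.inr κ) (Sum.inr l) = 0)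
    (hanti : ∀ (x y : Fin (d + 1) → ℤ) (κ l : Fin (d + 1)), Mh x y (Sum.inl κ) (Sum.inr l) = -Mh y x (Sum.inr l) (Sum.inl κ))
    {μ : Type*} [Fintype μ] [DecidableEq μ] (fμ : μ → Idx (towerTorus Lc M n) (Fib d)) (hfμ : Function.Injective fμ)
    (hμ : ∀ a : μ, ∃ m : Fin (d + 1), (fμ a).2 = Sum.inr m)
    (hcoarse : ∀ (s : ↥(pbox (towerTorus Lc M n))) (m : Fin (d + 1)),
      ((s, Sum.inr m) : Idx (towerTorus Lc M n) (Fib d)) ∈ Set.range fμ ↔ Torus.proj (bigRatio Lc n) (s : Site (d + 1)) = 0) :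
    (effForm
        ((perF (towerTorus Lc M n) Mh).submatrix (fun b : ↥(pbox (towerTorus Lc M n)) × Fin (d + 1) => ((b.1, Sum.inl b.2) : Idx (towerTorus Lc M n) (Fib d)))
          (fun b : ↥(pbox (towerTorus Lc M n)) × Fin (d + 1) => ((b.1, Sum.inl b.2) : Idx (towerTorus Lc M n) (Fib d))))
        (fromRows
          ((perF (towerTorus Lc M n) Mh).submatrix fμ
            (fun b : ↥(pbox (towerTorus Lc M n)) × Fin (d + 1) => ((b.1, Sum.inl b.2) : Idx (towerTorus Lc M n) (Fib d))))
          (bigP Lc M rs hrs n))).toBlocks₁₁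
      = (perF (towerTorus Lc M n) A).submatrix fμ fμ := by
  have hLc : 0 < Lc := Nat.pos_of_ne_zero (NeZero.ne Lc)
  haveI : NeZero (bigRatio Lc n) := ⟨(bigRatio_pos Lc hLc n).ne'⟩
  rw [bigP_eq_submatrix, effForm_toBlocks₁₁_fromRows_reindex]
  exact effForm_toBlocks₁₁_of_relInv_site (towerTorus Lc M n) (bigRoot_range Lc hLc n rs hrs) (bigRatio_dvd_towerTorus Lc hM n)
    hA hMh hAt hMt hrel hmm hanti fμ hfμ hμ hcoarse

end OneShot

end Summit.QuantumFields.BalabanUV.Beta.FP.RelInvPeriodisedOneShot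

end
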